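import Mathlib
import HarnessLib

/-!
# Route `KLProgramme` — ENGINE crux `KLRegimeEngineV17F2` (stmt-HubbardSuperconductivity-20437), row (C) `hcertA : KlwjCertA`:
# a SIGNED fixed-point interval arithmetic at scale `10¹⁸` for kernel-checked (`decide +kernel`) certificates (cell gate-hubbard-kl, seat p1b g19)

Generic, model-free.  An `FI` is a pair of integers `(lo, hi)` meaning the real interval `[lo, hi]/10¹⁸`; `FI.mem I x` says `x` lies in it.  Operations are
integer-only with OUTWARD rounding (floor/ceiling division, `Int.ediv`), so the kernel's GMP arithmetic decides a whole certificate in milliseconds while each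
operation carries a soundness lemma in `ℝ`:
* `FI.add / sub / neg / scale k` (exact), `FI.mul` (four corners, outward rounding), `FI.invPos` (`1/x` on a positive interval), `FI.ofFracs lo hi den`
  (imports a bracket `lo/den ≤ x ≤ hi/den`, e.g. the Taylor enclosures of `…FixedPointTrig`), `FI.supAbs` (an integer bound of `10¹⁸·|x|`);
* `FI.mem_add`, `mem_sub`, `mem_neg`, `mem_scale`, `mem_mul`, `mem_invPos`, `mem_ofFracs`, `abs_le_of_mem`.
Used by `…FreeBandSlopeDerivBoxes` (entries `D1`, `G1` of the polar-jet tables); intended to be reusable for the order ≥ 2 certificates.  Elementary;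
nothing about the Hubbard model is asserted. [folklore]
-/

namespace Summit.HubbardSuperconductivity.HubbardSuperconductivity.Theorems.PerturbedFermiCurve

set_option linter.dupNamespace false -- summit = problem name (single-conjunct summit), D-0017

open Real Set

/-! ## §1 The interval type and its integer operations -/

/-- A fixed-point interval `[lo, hi]/10¹⁸`. -/
structure FI where
  /-- `10¹⁸ ×` lower end -/
  lo : ℤ
  /-- `10¹⁸ ×` upper end -/
  hi : ℤ

namespace FI

/-- Membership: `lo ≤ 10¹⁸·x ≤ hi`. -/
def mem (I : FI) (x : ℝ) : Prop := (I.lo : ℝ) ≤ x * 10 ^ 18 ∧ x * 10 ^ 18 ≤ (I.hi : ℝ)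

/-- Ceiling division by a positive integer (`Int.ediv` is floor division for positive divisors). -/
def cdiv (n d : ℤ) : ℤ := -((-n) / d)

/-- Sum. -/
def add (I J : FI) : FI := ⟨I.lo + J.lo, I.hi + J.hi⟩
/-- Negation. -/
def neg (I : FI) : FI := ⟨-I.hi, -I.lo⟩
/-- Difference. -/
def sub (I J : FI) : FI := ⟨I.lo - J.hi, I.hi - J.lo⟩
/-- Multiplication by an integer constant (exact). -/
def scale (k : ℤ) (I : FI) : FI := ⟨min (k * I.lo) (k * I.hi), max (k * I.lo) (k * I.hi)⟩
/-- The integer `n` as a point interval. -/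
def ofInt (n : ℤ) : FI := ⟨n * 1000000000000000000, n * 1000000000000000000⟩
/-- Product (four corners, outward rounding). -/
def mul (I J : FI) : FI :=
  ⟨(min (min (I.lo * J.lo) (I.lo * J.hi)) (min (I.hi * J.lo) (I.hi * J.hi))) / 1000000000000000000,
    cdiv (max (max (I.lo * J.lo) (I.lo * J.hi)) (max (I.hi * J.lo) (I.hi * J.hi))) 1000000000000000000⟩
/-- Reciprocal of a POSITIVE interval (meaningful when `0 < I.lo`; outward rounding). -/
def invPos (I : FI) : FI := ⟨1000000000000000000000000000000000000 / I.hi, cdiv 1000000000000000000000000000000000000 I.lo⟩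
/-- Import of a rational bracket `[lo/den, hi/den]` (outward rounding). -/
def ofFracs (lo hi : ℤ) (den : ℕ) : FI := ⟨lo * 1000000000000000000 / (den : ℤ), cdiv (hi * 1000000000000000000) den⟩
/-- An integer bound of `10¹⁸·sup |x|` over the interval. -/
def supAbs (I : FI) : ℤ := max (-I.lo) I.hi

/-! ## §2 Soundness -/

/-- Floor division: `(n / d)·d ≤ n` in `ℝ`. -/
theorem ediv_mul_le_cast (n : ℤ) {d : ℤ} (hd : 0 < d) : ((n / d : ℤ) : ℝ) * d ≤ n := by
  exact_mod_cast Int.ediv_mul_le n hd.ne'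

/-- Ceiling division: `n ≤ cdiv n d · d` in `ℝ`. -/
theorem le_cdiv_mul_cast (n : ℤ) {d : ℤ} (hd : 0 < d) : (n : ℝ) ≤ ((cdiv n d : ℤ) : ℝ) * d := by
  have h : (((-n) / d : ℤ) : ℝ) * d ≤ ((-n : ℤ) : ℝ) := by exact_mod_cast Int.ediv_mul_le (-n) hd.ne'
  rw [cdiv]; push_cast at h ⊢; linarith

/-- Four corners, lower. -/
theorem corner_le_mul {a b c d X Y : ℝ} (ha : a ≤ X) (hb : X ≤ b) (hc : c ≤ Y) (hd : Y ≤ d) :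
    min (min (a * c) (a * d)) (min (b * c) (b * d)) ≤ X * Y := by
  rcases le_total 0 Y with hY | hY
  · -- `X*Y ≥ a*Y`, and `a*Y ≥ min (a*c) (a*d)`
    have h1 : a * Y ≤ X * Y := mul_le_mul_of_nonneg_right ha hY
    have h2 : min (a * c) (a * d) ≤ a * Y := by
      rcases le_total 0 a with ha0 | ha0
      · exact (min_le_left _ _).trans (mul_le_mul_of_nonneg_left hc ha0)
      · exact (min_le_right _ _).trans (mul_le_mul_of_nonpos_left hd ha0)
    exact (min_le_left _ _).trans (h2.trans h1)
  · have h1 : b * Y ≤ X * Y := mul_le_mul_of_nonpos_right hb hY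
    have h2 : min (b * c) (b * d) ≤ b * Y := by
      rcases le_total 0 b with hb0 | hb0
      · exact (min_le_left _ _).trans (mul_le_mul_of_nonneg_left hc hb0)
      · exact (min_le_right _ _).trans (mul_le_mul_of_nonpos_left hd hb0)
    exact (min_le_right _ _).trans (h2.trans h1)

/-- Four corners, upper. -/
theorem mul_le_corner {a b c d X Y : ℝ} (ha : a ≤ X) (hb : X ≤ b) (hc : c ≤ Y) (hd : Y ≤ d) :
    X * Y ≤ max (max (a * c) (a * d)) (max (b * c) (b * d)) := by
  rcases le_total 0 Y with hY | hY
  · -- `X*Y ≤ b*Y`, and `b*Y ≤ max (b*c) (b*d)`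
    have h1 : X * Y ≤ b * Y := mul_le_mul_of_nonneg_right hb hY
    have h2 : b * Y ≤ max (b * c) (b * d) := by
      rcases le_total 0 b with hb0 | hb0
      · exact le_trans (mul_le_mul_of_nonneg_left hd hb0) (le_max_right _ _)
      · exact le_trans (mul_le_mul_of_nonpos_left hc hb0) (le_max_left _ _)
    exact h1.trans (h2.trans (le_max_right _ _))
  · have h1 : X * Y ≤ a * Y := mul_le_mul_of_nonpos_right ha hY
    have h2 : a * Y ≤ max (a * c) (a * d) := by
      rcases le_total 0 a with ha0 | ha0
      · exact le_trans (mul_le_mul_of_nonneg_left hd ha0) (le_max_right _ _)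
      · exact le_trans (mul_le_mul_of_nonpos_left hc ha0) (le_max_left _ _)
    exact h1.trans (h2.trans (le_max_left _ _))

/-- Soundness of `add`. -/
theorem mem_add {I J : FI} {x y : ℝ} (hx : I.mem x) (hy : J.mem y) : (I.add J).mem (x + y) := by
  obtain ⟨h1, h2⟩ := hx; obtain ⟨h3, h4⟩ := hy
  refine ⟨?_, ?_⟩ <;> simp only [add] <;> push_cast <;> linarith

/-- Soundness of `neg`. -/
theorem mem_neg {I : FI} {x : ℝ} (hx : I.mem x) : I.neg.mem (-x) := by
  obtain ⟨h1, h2⟩ := hx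
  refine ⟨?_, ?_⟩ <;> simp only [neg] <;> push_cast <;> linarith

/-- Soundness of `sub`. -/
theorem mem_sub {I J : FI} {x y : ℝ} (hx : I.mem x) (hy : J.mem y) : (I.sub J).mem (x - y) := by
  obtain ⟨h1, h2⟩ := hx; obtain ⟨h3, h4⟩ := hy
  refine ⟨?_, ?_⟩ <;> simp only [sub] <;> push_cast <;> linarith

/-- Soundness of `scale`. -/
theorem mem_scale (k : ℤ) {I : FI} {x : ℝ} (hx : I.mem x) : (I.scale k).mem ((k : ℝ) * x) := by
  obtain ⟨h1, h2⟩ := hx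
  refine ⟨?_, ?_⟩ <;> simp only [scale] <;> push_cast
  · rcases le_total 0 (k : ℝ) with hk | hk
    · exact (min_le_left _ _).trans (by nlinarith)
    · exact (min_le_right _ _).trans (by nlinarith)
  · rcases le_total 0 (k : ℝ) with hk | hk
    · exact le_trans (by nlinarith) (le_max_right _ _)
    · exact le_trans (by nlinarith) (le_max_left _ _)

/-- Soundness of `ofInt`. -/
theorem mem_ofInt (n : ℤ) : (ofInt n).mem (n : ℝ) := by
  refine ⟨?_, ?_⟩ <;> simp only [ofInt] <;> push_cast <;> linarith

/-- Soundness of `mul`. -/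
theorem mem_mul {I J : FI} {x y : ℝ} (hx : I.mem x) (hy : J.mem y) : (I.mul J).mem (x * y) := by
  obtain ⟨h1, h2⟩ := hx; obtain ⟨h3, h4⟩ := hy
  have hW : (0 : ℝ) < 10 ^ 18 := by norm_num
  have hlo := corner_le_mul h1 h2 h3 h4
  have hhi := mul_le_corner h1 h2 h3 h4
  have e : x * 10 ^ 18 * (y * 10 ^ 18) = (x * y * 10 ^ 18) * 10 ^ 18 := by ring
  rw [e] at hlo hhi
  constructor
  · simp only [mul]
    have hf := ediv_mul_le_cast (min (min (I.lo * J.lo) (I.lo * J.hi)) (min (I.hi * J.lo) (I.hi * J.hi))) (d := 1000000000000000000) (by norm_num)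
    push_cast at hf ⊢
    nlinarith
  · simp only [mul]
    have hc := le_cdiv_mul_cast (max (max (I.lo * J.lo) (I.lo * J.hi)) (max (I.hi * J.lo) (I.hi * J.hi))) (d := 1000000000000000000) (by norm_num)
    push_cast at hc ⊢
    nlinarith

/-- Soundness of `invPos`: `1/x` for `x` in a positive interval. -/
theorem mem_invPos {I : FI} {x : ℝ} (hx : I.mem x) (hpos : 0 < I.lo) : I.invPos.mem (1 / x) := by
  obtain ⟨h1, h2⟩ := hx
  have hlo : (0 : ℝ) < I.lo := by exact_mod_cast hpos
  have hX : 0 < x * 10 ^ 18 := hlo.trans_le h1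
  have hx0 : 0 < x := by nlinarith
  have hhi0 : (0 : ℝ) < I.hi := hX.trans_le h2
  have hhi0' : (0 : ℤ) < I.hi := by exact_mod_cast hhi0
  have hq0 : (0 : ℝ) ≤ ((1000000000000000000000000000000000000 / I.hi : ℤ) : ℝ) := by exact_mod_cast Int.ediv_nonneg (by norm_num) hhi0'.le
  have hf := ediv_mul_le_cast (1000000000000000000000000000000000000 : ℤ) hhi0'
  have hc := le_cdiv_mul_cast (1000000000000000000000000000000000000 : ℤ) hpos
  constructor
  · simp only [invPos]
    rw [div_mul_eq_mul_div, one_mul, le_div_iff₀ hx0]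
    push_cast at hf hq0 ⊢
    nlinarith [mul_le_mul_of_nonneg_left h2 hq0]
  · simp only [invPos]
    rw [div_mul_eq_mul_div, one_mul, div_le_iff₀ hx0]
    push_cast at hc ⊢
    have hpos' : (0 : ℝ) < ((cdiv 1000000000000000000000000000000000000 I.lo : ℤ) : ℝ) := by
      by_contra hneg
      have hneg := le_of_not_gt hneg
      nlinarith
    nlinarith [mul_le_mul_of_nonneg_left h1 hpos'.le]

/-- Soundness of `ofFracs`. -/
theorem mem_ofFracs {lo hi : ℤ} {den : ℕ} (hden : 0 < den) {x : ℝ} (hlo : (lo : ℝ) ≤ x * den) (hhi : x * den ≤ (hi : ℝ)) :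
    (ofFracs lo hi den).mem x := by
  have hd : (0 : ℤ) < (den : ℤ) := by exact_mod_cast hden
  have hdr : (0 : ℝ) < (den : ℝ) := by exact_mod_cast hden
  have hf := ediv_mul_le_cast (lo * 1000000000000000000) hd
  have hc := le_cdiv_mul_cast (hi * 1000000000000000000) hd
  constructor
  · simp only [ofFracs]
    push_cast at hf ⊢
    nlinarith
  · simp only [ofFracs]
    push_cast at hc ⊢
    nlinarith

/-- The absolute bound. -/
theorem abs_le_of_mem {I : FI} {x : ℝ} (hx : I.mem x) : |x| * 10 ^ 18 ≤ (I.supAbs : ℝ) := by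
  obtain ⟨h1, h2⟩ := hx
  rw [supAbs]; push_cast
  rcases le_total 0 x with h | h
  · rw [abs_of_nonneg h]; exact h2.trans (le_max_right _ _)
  · rw [abs_of_nonpos h]; exact le_trans (by linarith) (le_max_left _ _)

end FI

end Summit.HubbardSuperconductivity.HubbardSuperconductivity.Theorems.PerturbedFermiCurve
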